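import Summits.AnomalousDissipation.AnomalousDissipation.Theorems.SolenoidalFractalHomogenisationLagrangianStepBandKillLadder
import Summits.AnomalousDissipation.AnomalousDissipation.Theorems.SolenoidalFractalHomogenisationLagrangianStepBandKillLadderBounds
import Summits.AnomalousDissipation.AnomalousDissipation.Theorems.SolenoidalFractalHomogenisationLagrangianCarrierAnalyticTowerStep
import HarnessLib

/-!
# W3-E (ii) `stub_effectiveFrameEnergyL_bandKill`: the LONG-SEPARATION branch (`L ≥ 2000`) — choice of the cube ladder
# (helper for K1L_D `stmt-AnomalousDissipation-27980`)

Summits-side helper file (everything proved; no definitions, no named facts).  `bandKill_largeL`: constants `C₂ ≥ 10⁵`, `θ₁`, `c₃` are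
chosen from the carrier-independent moduli of `ladder_clauses` (`CL`, `ρ_s`, `C_b`), and for `2L' ≤ L`, `L ≥ 2000`, a genuine window
`s < s′`, `T ∈ {Um s s′, (Um s s′)†}` both band-kill clauses of the stub follow from `ladder_clauses` with the ladder: box radius `R = 4L/7`,
shell width `Δ = ⌊C_Δ θL⌋ + 1` (`C_Δ = 864π·CL`), rung size `S = 4Δ + 4 + ⌊κ_S θL⌋ + ⌊κ_N N_m⌋` (`κ_N = 8c₁`, `κ_S = 120000 C_b c₁`,
`c₁ = 4e·21³ρ_s`) when it fits below the room `R − L' − 2Δ` (several rungs, ratio `x = 3`), else one rung filling the room; the ladder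
condition is `termA_le_half + termB_{one,multi}_le_half`, the leak comparison is `leak_{one,multi}`. Infrastructure for route-1's rung leaf
F-D1.A0 (a frontier FORMAL rung); NOT a proof of anomalous dissipation.
-/

set_option linter.dupNamespace false

namespace Summit.AnomalousDissipation.AnomalousDissipation.Theorems.SolenoidalFractalHomogenisation.LagrangianStep

open Literature.Analysis Literature.Analysis.FluidPDE Literature.Analysis.FunctionSpaces
open MeasureTheory Set Filter Function
open scoped ENNReal NNReal InnerProductSpace
open Literature.Analysis.FluidPDE.LatticeShear
open Summit.AnomalousDissipation.AnomalousDissipation.Theorems.SolenoidalFractalHomogenisation.LagrangianCarrierAnalytic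
  (three_mul_sq_div_le box_radius_bounds N_mono)
open LadderArith

noncomputable section

/-- Window strain: `(Σ_{i<m} a_{i+1})·(s′−s) ≤ 2θ_{m+1}` on a window of length `≤ 2·refresh(m+1)`. -/
theorem sum_a_mul_window_le {k : ℕ} (E : LagrangianLatticeCarrier k) (hLP : E.LPermissible) (m : ℕ) {s s' : ℝ}
    (hlen : s' - s ≤ 2 * E.refresh (m + 1)) : (∑ i ∈ Finset.range m, E.a (i + 1)) * (s' - s) ≤ 2 * E.θ (m + 1) := by
  have hstrain := hLP.strain_le m
  unfold LagrangianLatticeCarrier.strain at hstrain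
  have hS0 : 0 ≤ ∑ i ∈ Finset.range m, E.a (i + 1) := Finset.sum_nonneg fun i _ => (E.a_pos _).le
  calc (∑ i ∈ Finset.range m, E.a (i + 1)) * (s' - s) ≤ (∑ i ∈ Finset.range m, E.a (i + 1)) * (2 * E.refresh (m + 1)) :=
        mul_le_mul_of_nonneg_left hlen hS0
    _ = 2 * ((∑ i ∈ Finset.range m, E.a (i + 1)) * E.refresh (m + 1)) := by ring
    _ ≤ 2 * E.θ (m + 1) := by linarith

set_option maxHeartbeats 400000 in
/-- **W3-E (ii), LONG-SEPARATION BRANCH** (see the module docstring): the two band-kill clauses for `2L' ≤ L`, `2000 ≤ L`, `s < s′`,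
with the constants `C₂, θ₁, c₃` of this file. -/
theorem bandKill_largeL : ∀ k (W : Literature.Analysis.FluidPDE.LatticeShear.LatticeWord k) (M : ℝ) (hM : 0 < M) (c : ℝ), 0 < c →
    ∀ (Φ : ℝ → Torus.Visc4 (Fin 3) → Torus.Visc4 (Fin 3)) (lo hi β : ℝ), 0 < lo → lo ≤ 1 → 1 ≤ hi → 0 ≤ β →
      ∃ C₂ ≥ (100000:ℝ), ∃ θ₁ > (0:ℝ), ∃ c₃ > (0:ℝ),
        ∀ E : Literature.Analysis.FluidPDE.LatticeShear.LagrangianLatticeCarrier k, E.design = W.stretch M hM → E.gain = c →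
          E.LPermissible → E.Regular → (∀ i, E.θ (i + 1) ≤ θ₁) → (∀ m, E.N m ^ 2 ≤ E.N (m + 1)) →
        ∀ (m : ℕ),
        ∀ (S : Torus.Visc4 (Fin 3)), Torus.OddSmall S β → Torus.NearIso S lo hi →
          Torus.OddSmall (Φ (E.cellVisc (m + 1)) S) β → Torus.NearIso (Φ (E.cellVisc (m + 1)) S) lo hi →
        ∀ Um : ℝ → ℝ → (V2 →L[ℝ] V2),
          Torus.IsPropagator 1 (E.partialSum m) (E.kbar m • renormStep (Φ (E.cellVisc (m + 1))) (E.gain / E.cellVisc (m + 1) ^ 2) S) Um →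
        ∀ (s s' : ℝ), 0 ≤ s → s < s' → s' ≤ 1 → s' - s ≤ 2 * E.refresh (m + 1) →
        ∀ T : V2 →L[ℝ] V2, (T = Um s s' ∨ T = ContinuousLinearMap.adjoint (Um s s')) →
        ∀ L' L : ℕ, 2 * L' ≤ L → 2000 ≤ L →
          (∀ y : V2,
              ‖T y - cutLp L (T y)‖
                ≤ Real.exp (-(E.a (m + 1) * (8 * Real.pi ^ 2 * (L' : ℝ) ^ 2 * lo * (E.cellVisc (m + 1) + c / E.cellVisc (m + 1))
                    / (E.N (m + 1) : ℝ) ^ 2) * (s' - s) / 2)) * ‖y - cutLp L' y‖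
                  + (Real.exp (-(c₃ / E.θ (m + 1))) + Real.exp (-(((L : ℝ) - L') / (C₂ * E.N m)))) * ‖y‖) ∧
          (∀ y : V2, cutLp L y = 0 →
              ‖T y‖
                ≤ (Real.exp (-(E.a (m + 1) * (8 * Real.pi ^ 2 * (L' : ℝ) ^ 2 * lo * (E.cellVisc (m + 1) + c / E.cellVisc (m + 1))
                    / (E.N (m + 1) : ℝ) ^ 2) * (s' - s) / 2))
                  + (Real.exp (-(c₃ / E.θ (m + 1))) + Real.exp (-(((L : ℝ) - L') / (C₂ * E.N m))))) * ‖y‖) := by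
  intro k W M hM c hc Φ lo hi β hlo hlo1 hhi hβ
  obtain ⟨θ₂, hθ₂, CL, hCL, ρs, hρs, Cb, hCb, hLad⟩ := ladder_clauses k W M hM c hc Φ lo hi β hlo hlo1 hhi hβ
  -- the constants
  obtain ⟨c₁, hc₁⟩ : ∃ c₁ : ℝ, c₁ = 4 * Real.exp 1 * 21 ^ 3 * ρs := ⟨_, rfl⟩
  have hc₁0 : 0 < c₁ := by rw [hc₁]; positivity
  obtain ⟨CΔ, hCΔ⟩ : ∃ CΔ : ℝ, CΔ = 864 * Real.pi * CL := ⟨_, rfl⟩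
  have hCΔ0 : 0 ≤ CΔ := by rw [hCΔ]; positivity
  obtain ⟨κN, hκN⟩ : ∃ κN : ℝ, κN = 8 * c₁ := ⟨_, rfl⟩
  have hκN0 : 0 < κN := by rw [hκN]; positivity
  obtain ⟨κS, hκS⟩ : ∃ κS : ℝ, κS = 120000 * Cb * c₁ := ⟨_, rfl⟩
  have hκS0 : 0 < κS := by rw [hκS]; positivity
  obtain ⟨cJ, hcJ⟩ : ∃ cJ : ℝ, cJ = 4 * CΔ + κS := ⟨_, rfl⟩
  have hcJ0 : 0 < cJ := by rw [hcJ]; positivity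
  refine ⟨max 100000 (1200 * (κN + 1)), le_max_left _ _,
    min θ₂ (min (1 / (336 * CΔ + 1)) (min (1 / (112 * κS + 1)) (min (1 / (1596672 * Real.pi * Cb * c₁ + 1)) (1 / (504 * (cJ + 1)))))),
    lt_min hθ₂ (lt_min (by positivity) (lt_min (by positivity) (lt_min (by positivity) (by positivity)))),
    1 / (168 * (cJ + 1)), by positivity, ?_⟩
  intro E hdes hgain hLP hReg hθ hsq m S hS₁ hS₂ hS₃ hS₄ Um hUm s s' hs hlt hs'1 hlen T hT L' L hL hL2000
  have hP := hLP.permissible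
  have hN2 : ∀ m, 2 * E.N m ≤ E.N (m + 1) := hP.2.2.1
  have hN : ∀ i, (0 : ℝ) < E.N i := fun i => by exact_mod_cast E.N_pos i
  have hNm : (1 : ℝ) ≤ E.N m := by exact_mod_cast E.N_pos m
  have hθp : 0 < E.θ (m + 1) := E.θ_pos _
  -- the ceilings
  have hθ₂' : ∀ i, E.θ (i + 1) ≤ θ₂ := fun i => (hθ i).trans (min_le_left _ _)
  have hθr := (hθ m).trans (min_le_right _ _)
  have hθ336 : E.θ (m + 1) * (336 * CΔ + 1) ≤ 1 := (le_div_iff₀ (by positivity)).1 (hθr.trans (min_le_left _ _))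
  have hθ112 : E.θ (m + 1) * (112 * κS + 1) ≤ 1 :=
    (le_div_iff₀ (by positivity)).1 (hθr.trans ((min_le_right _ _).trans (min_le_left _ _)))
  have hθB : E.θ (m + 1) * (1596672 * Real.pi * Cb * c₁ + 1) ≤ 1 :=
    (le_div_iff₀ (by positivity)).1 (hθr.trans ((min_le_right _ _).trans ((min_le_right _ _).trans (min_le_left _ _))))
  have hθJ : E.θ (m + 1) * (504 * (cJ + 1)) ≤ 1 :=
    (le_div_iff₀ (by positivity)).1 (hθr.trans ((min_le_right _ _).trans ((min_le_right _ _).trans (min_le_right _ _))))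
  have hθB' : E.θ (m + 1) * (1596672 * Real.pi * Cb * c₁) ≤ 1 := by nlinarith [hθp]
  -- window strain and casts
  have hτ0 : 0 < s' - s := by linarith
  have hstrainτ := sum_a_mul_window_le E hLP m hlen
  have hLr : (2000 : ℝ) ≤ L := by exact_mod_cast hL2000
  have hL'r : 2 * (L' : ℝ) ≤ L := by exact_mod_cast hL
  have hL'0 : (0 : ℝ) ≤ L' := Nat.cast_nonneg L'
  -- the box radius
  obtain ⟨R, hRdef⟩ : ∃ R : ℕ, R = 4 * L / 7 := ⟨_, rfl⟩
  have hR3 : 3 * R ^ 2 ≤ L ^ 2 := hRdef ▸ three_mul_sq_div_le L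
  have hRlo : 4 * (L : ℝ) / 7 - 1 ≤ R := hRdef ▸ (box_radius_bounds L).1
  have hRL : R ≤ L := by omega
  -- the shell width
  obtain ⟨Δ, hΔdef⟩ : ∃ Δ : ℕ, Δ = ⌊CΔ * E.θ (m + 1) * L⌋₊ + 1 := ⟨_, rfl⟩
  have hΔpos : 0 < Δ := by omega
  have hy0 : 0 ≤ CΔ * E.θ (m + 1) * L := by positivity
  have hΔlo : CΔ * E.θ (m + 1) * L ≤ Δ := hΔdef ▸ (floor_succ_bounds hy0).1
  have hΔhi : (Δ : ℝ) ≤ CΔ * E.θ (m + 1) * L + 1 := hΔdef ▸ (floor_succ_bounds hy0).2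
  have hΔr : (0 : ℝ) < Δ := by exact_mod_cast hΔpos
  -- the room below the radius
  have hroomR : (L : ℝ) / 28 + 4 * Δ + 2 + (L' + 2 * Δ) ≤ R := room_le_radius hRlo hL'r hΔhi hθp.le hθ336 (by linarith)
  have hLR : L' + 2 * Δ ≤ R := by
    have : ((L' + 2 * Δ : ℕ) : ℝ) ≤ R := by push_cast; nlinarith [hΔr]
    exact_mod_cast this
  obtain ⟨room, hroomdef⟩ : ∃ room : ℕ, room = R - (L' + 2 * Δ) := ⟨_, rfl⟩
  have hroomc : (room : ℝ) = R - (L' + 2 * Δ) := by rw [hroomdef, Nat.cast_sub hLR]; push_cast; ring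
  have hroom : (L : ℝ) / 28 + 4 * Δ + 2 ≤ room := by rw [hroomc]; linarith
  -- the many-rung size
  obtain ⟨SM, hSMdef⟩ : ∃ SM : ℕ, SM = 4 * Δ + 4 + ⌊κS * E.θ (m + 1) * L⌋₊ + ⌊κN * (E.N m : ℝ)⌋₊ := ⟨_, rfl⟩
  have hy1 : 0 ≤ κS * E.θ (m + 1) * L := by positivity
  have hy2 : 0 ≤ κN * (E.N m : ℝ) := by positivity
  have hSMhi : (SM : ℝ) ≤ 4 * Δ + 4 + κS * E.θ (m + 1) * L + κN * E.N m := by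
    rw [hSMdef]; push_cast; linarith [(floor_bounds hy1).1, (floor_bounds hy2).1]
  have hSMlo : κS * E.θ (m + 1) * L + κN * E.N m ≤ SM := by
    rw [hSMdef]; push_cast; linarith [(floor_bounds hy1).2, (floor_bounds hy2).2]
  have hSM4 : 4 * Δ + 2 ≤ SM := by omega
  -- ### the common bookkeeping for a rung size `Sr ≤ room`
  have key : ∀ Sr : ℕ, 2 * Δ + 2 ≤ Sr → Sr ≤ room →
      (∀ K : ℝ, 0 ≤ K → K ≤ L → 4 * Real.pi * K * (s' - s) * 3 * (3 * ∑ n ∈ Finset.range (room / Sr),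
        (∑ i ∈ Finset.range m, 66 * (Cb * (E.a (i + 1) / E.N (i + 1))) *
          Real.exp (-(((((n + 1) * Sr - 2 * Δ : ℕ) : ℝ) - 1) / 2 / (c₁ * E.N (i + 1))))) * 3 ^ (n + 1)) ≤ 1 / 2) →
      2 * (3 : ℝ)⁻¹ ^ (room / Sr) ≤ Real.exp (-(1 / (168 * (cJ + 1)) / E.θ (m + 1))) +
        Real.exp (-(((L : ℝ) - L') / (max 100000 (1200 * (κN + 1)) * E.N m))) →
      (∀ y : V2, ‖T y - cutLp L (T y)‖
          ≤ Real.exp (-(E.a (m + 1) * (8 * Real.pi ^ 2 * (L' : ℝ) ^ 2 * lo * (E.cellVisc (m + 1) + c / E.cellVisc (m + 1))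
              / (E.N (m + 1) : ℝ) ^ 2) * (s' - s) / 2)) * ‖y - cutLp L' y‖
            + (Real.exp (-(1 / (168 * (cJ + 1)) / E.θ (m + 1))) +
                Real.exp (-(((L : ℝ) - L') / (max 100000 (1200 * (κN + 1)) * E.N m)))) * ‖y‖) ∧
      (∀ y : V2, cutLp L y = 0 → ‖T y‖
          ≤ (Real.exp (-(E.a (m + 1) * (8 * Real.pi ^ 2 * (L' : ℝ) ^ 2 * lo * (E.cellVisc (m + 1) + c / E.cellVisc (m + 1))
              / (E.N (m + 1) : ℝ) ^ 2) * (s' - s) / 2))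
            + (Real.exp (-(1 / (168 * (cJ + 1)) / E.θ (m + 1))) +
                Real.exp (-(((L : ℝ) - L') / (max 100000 (1200 * (κN + 1)) * E.N m))))) * ‖y‖) := by
    intro Sr hSr2 hSrroom hB hleak
    have hSrpos : 0 < Sr := by omega
    obtain ⟨q, hqdef⟩ : ∃ q : ℕ, q = room / Sr := ⟨_, rfl⟩
    have hq1 : 1 ≤ q := hqdef ▸ Nat.div_pos hSrroom hSrpos
    have hqS : q * Sr ≤ room := hqdef ▸ Nat.div_mul_le_self room Sr
    obtain ⟨J, hJdef⟩ : ∃ J : ℕ, J = q - 1 := ⟨_, rfl⟩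
    have hJq : J + 1 = q := by omega
    obtain ⟨K₀, hK₀def⟩ : ∃ K₀ : ℕ, K₀ = L' + J * Sr := ⟨_, rfl⟩
    have hsm : (J + 1) * Sr = J * Sr + Sr := Nat.succ_mul J Sr
    have hJ' : (J + 1) * Sr ≤ K₀ + Sr := by rw [hsm, hK₀def]; omega
    have hrung : L' ≤ Torus.rungHeight K₀ Sr (J + 1) := by unfold Torus.rungHeight; rw [hsm, hK₀def]; omega
    have hqS' : J * Sr + Sr ≤ room := by rw [← hsm, hJq]; exact hqS
    have htop : K₀ + Sr + 2 * Δ ≤ R := by rw [hK₀def]; omega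
    have hRL' : 3 * (K₀ + Sr + 2 * Δ) ^ 2 ≤ L ^ 2 := le_trans (Nat.mul_le_mul_left 3 (Nat.pow_le_pow_left htop 2)) hR3
    have hK0 : (0 : ℝ) ≤ K₀ + 2 * Δ := by positivity
    have hKL : (K₀ : ℝ) + 2 * Δ ≤ L := by
      have h : K₀ + 2 * Δ ≤ L := by omega
      exact_mod_cast h
    -- term A
    have hA0 : 0 ≤ ∑ i ∈ Finset.range m, E.a (i + 1) := Finset.sum_nonneg fun i _ => (E.a_pos _).le
    have hΔge : 864 * Real.pi * CL * E.θ (m + 1) * L ≤ Δ := by rw [hCΔ] at hΔlo; linarith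
    have hA := termA_le_half hK0 hKL hCL hA0 hτ0.le hstrainτ hΔr hΔge
    -- the ladder condition
    have hc₁N : ∀ y : ℝ, 4 * Real.exp 1 * 21 ^ 3 * (ρs * y) = c₁ * y := fun y => by rw [hc₁]; ring
    have hB' := hB ((K₀ : ℝ) + 2 * Δ) hK0 hKL
    rw [← hqdef, ← hJq] at hB'
    have hladder : 4 * Real.pi * (K₀ + 2 * Δ) * (s' - s) * 3 *
        (2 * 3 ^ 2 * (CL * ∑ i ∈ Finset.range m, E.a (i + 1)) / Δ +
          3 * ∑ n ∈ Finset.range (J + 1), (∑ i ∈ Finset.range m, 66 * (Cb * (E.a (i + 1) / E.N (i + 1))) *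
            Real.exp (-(((((n + 1) * Sr - 2 * Δ : ℕ) : ℝ) - 1) / 2 / (4 * Real.exp 1 * 21 ^ 3 * (ρs * E.N (i + 1)))))) *
              (3:ℝ) ^ (n + 1)) ≤ 1 := by
      simp only [hc₁N]
      rw [mul_add]; linarith
    rw [← hqdef, ← hJq] at hleak
    exact hLad E hdes hgain hLP hReg hθ₂' hsq m S hS₁ hS₂ hS₃ hS₄ Um hUm s s' hs hlt hs'1 hlen T hT K₀ Sr Δ J 3 hΔpos hSr2 hJ'
      (by norm_num) hladder L' L hRL' hrung _ hleak
  -- ### the two regimes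
  by_cases hfit : SM ≤ room
  · -- several rungs of size `SM`
    refine key SM (by omega) hfit (fun K hK0 hKL => ?_) ?_
    · refine termB_multi_le_half (fun i => E.a (i + 1)) (fun i => (E.N (i + 1) : ℝ)) (fun i => (E.a_pos _).le) (fun i => hN _)
        hK0 hKL hτ0.le hstrainτ hθp hc₁0 hCb hSM4 (fun i hi => ?_) (room / SM)
      have him : E.N (i + 1) ≤ E.N m := N_mono E hN2 (by simpa using Finset.mem_range.1 hi)
      have him' : (E.N (i + 1) : ℝ) ≤ E.N m := by exact_mod_cast him
      rw [← hκS]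
      have : 8 * c₁ * (E.N (i + 1) : ℝ) ≤ κN * E.N m := by rw [hκN]; exact mul_le_mul_of_nonneg_left him' (by positivity)
      linarith
    · have hSMpos : 0 < SM := by omega
      have hdiv := lt_nat_div_mul_add room hSMpos
      have hq1 : 1 ≤ room / SM := Nat.div_pos hfit hSMpos
      have hSMhi' : (SM : ℝ) ≤ cJ * E.θ (m + 1) * L + κN * E.N m + 8 := by rw [hcJ]; linarith [hΔhi, hSMhi]
      exact leak_multi hq1 hdiv (by exact_mod_cast hSMpos) (by linarith [hroom, hΔr]) hSMhi' hcJ0 hκN0 hNm hθp (le_max_left _ _)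
        (le_max_right _ _) le_rfl hθJ hLr hL'0
  · -- one rung filling the room
    push Not at hfit
    have hroom2 : 2 * Δ + 2 ≤ room := by
      have h : ((2 * Δ + 2 : ℕ) : ℝ) ≤ room := by
        push_cast; have : (0 : ℝ) ≤ L := Nat.cast_nonneg L; linarith
      exact_mod_cast h
    have hroompos : 0 < room := by omega
    have hkN : (L : ℝ) / 56 < κN * E.N m :=
      kN_large_of_not_fit (by exact_mod_cast hfit) hSMhi hroom hθp.le hθ112 (by linarith)
    refine key room hroom2 le_rfl (fun K hK0 hKL => ?_) ?_
    · rw [Nat.div_self hroompos]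
      refine termB_one_le_half (fun i => E.a (i + 1)) (fun i => (E.N (i + 1) : ℝ)) (fun i => (E.a_pos _).le) (fun i => hN _)
        hK0 hKL hτ0.le hstrainτ hc₁0 hCb hθB' fun n => ?_
      have hle : 2 * Δ ≤ (n + 1) * room := le_trans (by omega) (Nat.le_mul_of_pos_left room (Nat.succ_pos n))
      rw [Nat.cast_sub hle]; push_cast
      have : (room : ℝ) ≤ ((n : ℝ) + 1) * room := by
        have hn : (0 : ℝ) ≤ n := Nat.cast_nonneg n
        have hr : (0 : ℝ) ≤ room := Nat.cast_nonneg room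
        exact le_mul_of_one_le_left hr (by linarith)
      linarith
    · rw [Nat.div_self hroompos]
      exact leak_one hkN hκN0 (le_max_right _ _) hNm hL'0 (Nat.cast_nonneg L)

end

end Summit.AnomalousDissipation.AnomalousDissipation.Theorems.SolenoidalFractalHomogenisation.LagrangianStep
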